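import Mathlib
import HarnessLib.Audit
import Summits.PneNP.PneNP.Theorems.PstarChordReadSlackTwo

/-!
# Slack two, II: four slice-generic chords kill a terminal core; O1 up to fourteen outputs (ROUND-24; memo g22 §24)

FRONTIER range-avoidance ladder, rung F-N3, ROUND 24 (cell `pnp-ideate`, prover-2 memo `g22/O1-PAIRCORE-g22.md` §24; typed target
`PstarCoreBoundTargets.TerminalPeelable` (p646951); restricted-model proof complexity — nothing here bears on `P` versus `NP`).

* `no_two_sharing_pairs` (F3) — at slack two no two disjoint pairs of chords have shared partners (four inserted gates cost `+2, 0, +2, 0`);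
* **`false_of_slackTwo_four_generic`** — FOUR distinct slice-generic chords kill a terminal core with `2·#bdry J₀ ≤ 3·#J₀ + 2`: if some two of them
  share a partner, the other two are outside-gated (`PstarChordReadSlackTwo.outsideGated_of_shared`) and cannot share one (F3, F3′); otherwise two
  of them are outside-gated (F1 twice); either way `PstarChordReadTwoChords.false_of_two_gated` ends it;
* `slackTwo_of_centre_fourteen`, **`peelable_of_card_le_fourteen`** — O1 for cores of at most fourteen outputs from (H₁₂), (H₁₃) and (H₁₄): four
  distinct slice-generic chords on every fourteen-output terminal core with a centre cycle and `#bdry ≤ 22`.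

No Assumption A.
-/

set_option linter.dupNamespace false -- `Summit.PneNP.PneNP.…`: summit = sub-problem name (D-0017 single-conjunct layout)

open Finset Literature.Computability.Complexity
open Summit.PneNP.PneNP.Theorems.PstarTyped (Typed)
open Summit.PneNP.PneNP.Theorems.PstarSALevel (varSet bdry BoundaryExpanding SimpleOverlap)
open Summit.PneNP.PneNP.Theorems.PstarCoreBound (XorClosed)
open Summit.PneNP.PneNP.Theorems.PstarXCore (xverts)
open Summit.PneNP.PneNP.Theorems.PstarChordRepair (IsChord)
open Summit.PneNP.PneNP.Theorems.PstarCoreBoundTargets (Terminal nonchords)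
open Summit.PneNP.PneNP.Theorems.PstarSharingBound (sharedSlots card_bdry_add_card_sharedSlots_le)
open Summit.PneNP.PneNP.Theorems.PstarChordBridgeTools (xpdeg)
open Summit.PneNP.PneNP.Theorems.PstarChordBridgeCotree (Peelable)
open Summit.PneNP.PneNP.Theorems.PstarChordReadLemma (SliceGeneric)
open Summit.PneNP.PneNP.Theorems.PstarChordReadOutside (IsGate OutsideGated Partner)
open Summit.PneNP.PneNP.Theorems.PstarChordReadTwoChords (false_of_two_gated)
open Summit.PneNP.PneNP.Theorems.PstarChordReadTight (card_bdry_insert_le_gen not_mem_and_card)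
open Summit.PneNP.PneNP.Theorems.PstarTerminalPeelableTwelve (twelve_le_two_mul_card_sharedSlots exists_centre_of_not_peelable)
open Summit.PneNP.PneNP.Theorems.PstarChordReadSlackOne (mem_varSet_of_pair mem_bdry_insert_of_not_mem peelable_of_card_le_thirteen)
open Summit.PneNP.PneNP.Theorems.PstarChordReadSlackTwo

namespace Summit.PneNP.PneNP.Theorems.PstarChordReadSlackTwoFour

variable {n m : ℕ}

section Counts

variable {I : LocalMap 4 n m} {r : ℕ} {y : Fin m → Bool} {J₀ : Finset (Fin m)} {w₁ w₂ : Finset (Fin n) × Finset (Fin m) × Bool}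

/-- **(F3) At slack two, no two disjoint pairs of chords have shared partners.** -/
theorem no_two_sharing_pairs (hT : Typed I) (hB : BoundaryExpanding r I) (ht : Terminal I r y J₀ w₁ w₂)
    (hslack : 2 * (bdry I J₀).card ≤ 3 * J₀.card + 2) {cₐ c_b c_c c_d : Fin m} (hcₐ : cₐ ∈ J₀) (hc_b : c_b ∈ J₀) (hc_c : c_c ∈ J₀)
    (hc_d : c_d ∈ J₀) (hab : cₐ ≠ c_b) (hac : cₐ ≠ c_c) (had : cₐ ≠ c_d) (hbc : c_b ≠ c_c) (hbd : c_b ≠ c_d) (hcd : c_c ≠ c_d)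
    (hchₐ : IsChord I J₀ cₐ) (hch_b : IsChord I J₀ c_b) (hch_c : IsChord I J₀ c_c) (hch_d : IsChord I J₀ c_d) {z z' : Fin n} (hzz : z ≠ z')
    (hPₐ : Partner I J₀ (w₁.2.1 ∪ w₂.2.1) cₐ z) (hP_b : Partner I J₀ (w₁.2.1 ∪ w₂.2.1) c_b z)
    (hP_c : Partner I J₀ (w₁.2.1 ∪ w₂.2.1) c_c z') (hP_d : Partner I J₀ (w₁.2.1 ∪ w₂.2.1) c_d z') : False := by
  classical
  obtain ⟨gₐ, hgₐ, vₐ, hGₐ⟩ := hPₐ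
  obtain ⟨g_b, hg_b, v_b, hG_b⟩ := hP_b
  obtain ⟨g_c, hg_c, v_c, hG_c⟩ := hP_c
  obtain ⟨g_d, hg_d, v_d, hG_d⟩ := hP_d
  obtain ⟨hgₐJ, -⟩ := not_mem_and_card ht hgₐ
  obtain ⟨hg_bJ, -⟩ := not_mem_and_card ht hg_b
  obtain ⟨hg_cJ, -⟩ := not_mem_and_card ht hg_c
  obtain ⟨hg_dJ, -⟩ := not_mem_and_card ht hg_d
  obtain ⟨-, bₐ⟩ := priv_mem hchₐ hGₐ.1
  obtain ⟨-, b_b⟩ := priv_mem hch_b hG_b.1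
  obtain ⟨m_c, b_c⟩ := priv_mem hch_c hG_c.1
  obtain ⟨-, b_d⟩ := priv_mem hch_d hG_d.1
  have hzₐ : z ∈ varSet I gₐ := (mem_varSet_of_pair hGₐ.2.1).2
  have hz'_c : z' ∈ varSet I g_c := (mem_varSet_of_pair hG_c.2.1).2
  have hv_bz : v_b ≠ z := hG_b.ne hc_b
  have hv_cz : v_c ≠ z := fun e => hGₐ.2.2 c_c hc_c (e ▸ m_c)
  have hv_dz : v_d ≠ z := fun e => hGₐ.2.2 c_d hc_d (e ▸ (priv_mem hch_d hG_d.1).1)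
  have hv_dz' : v_d ≠ z' := hG_d.ne hc_d
  have hv_bgₐ : v_b ∉ varSet I gₐ := priv_not_mem_varSet hT hGₐ.2.1 hG_b.1 (priv_ne hcₐ hc_b hab hchₐ hch_b hGₐ.1 hG_b.1).symm hv_bz
  have hv_cgₐ : v_c ∉ varSet I gₐ := priv_not_mem_varSet hT hGₐ.2.1 hG_c.1 (priv_ne hcₐ hc_c hac hchₐ hch_c hGₐ.1 hG_c.1).symm hv_cz
  have hv_cg_b : v_c ∉ varSet I g_b :=
    priv_not_mem_varSet hT hG_b.2.1 hG_c.1 (priv_ne hc_b hc_c hbc hch_b hch_c hG_b.1 hG_c.1).symm hv_cz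
  have hv_dgₐ : v_d ∉ varSet I gₐ := priv_not_mem_varSet hT hGₐ.2.1 hG_d.1 (priv_ne hcₐ hc_d had hchₐ hch_d hGₐ.1 hG_d.1).symm hv_dz
  have hv_dg_b : v_d ∉ varSet I g_b :=
    priv_not_mem_varSet hT hG_b.2.1 hG_d.1 (priv_ne hc_b hc_d hbd hch_b hch_d hG_b.1 hG_d.1).symm hv_dz
  have hv_dg_c : v_d ∉ varSet I g_c :=
    priv_not_mem_varSet hT hG_c.2.1 hG_d.1 (priv_ne hc_c hc_d hcd hch_c hch_d hG_c.1 hG_d.1).symm hv_dz'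
  -- `z'` is an AND variable of `g_c`, hence (typed) not an XOR variable of `gₐ, g_b`; it is neither private (inside) nor `z`
  have hz'v : z' = I.vars g_c 2 ∨ z' = I.vars g_c 3 := by
    rcases hG_c.2.1 with ⟨-, h3⟩ | ⟨h2, -⟩
    exacts [Or.inr h3.symm, Or.inl h2.symm]
  have hz'vₐ : z' ≠ vₐ := fun e => hG_c.2.2 cₐ hcₐ (e ▸ (priv_mem hchₐ hGₐ.1).1)
  have hz'v_b : z' ≠ v_b := fun e => hG_c.2.2 c_b hc_b (e ▸ (priv_mem hch_b hG_b.1).1)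
  have hz'gₐ : z' ∉ varSet I gₐ := priv_not_mem_varSet hT hGₐ.2.1 hz'v hz'vₐ hzz.symm
  have hz'g_b : z' ∉ varSet I g_b := priv_not_mem_varSet hT hG_b.2.1 hz'v hz'v_b hzz.symm
  have hg_bX : g_b ∉ insert gₐ J₀ := fun h' => by
    rcases mem_insert.1 h' with e | h'
    · exact hv_bgₐ (e ▸ (mem_varSet_of_pair hG_b.2.1).1)
    · exact hg_bJ h'
  have hg_cX : g_c ∉ insert g_b (insert gₐ J₀) := fun h' => by
    rcases mem_insert.1 h' with e | h'
    · exact hv_cg_b (e ▸ (mem_varSet_of_pair hG_c.2.1).1)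
    rcases mem_insert.1 h' with e | h'
    · exact hv_cgₐ (e ▸ (mem_varSet_of_pair hG_c.2.1).1)
    · exact hg_cJ h'
  have hg_dX : g_d ∉ insert g_c (insert g_b (insert gₐ J₀)) := fun h' => by
    rcases mem_insert.1 h' with e | h'
    · exact hv_dg_c (e ▸ (mem_varSet_of_pair hG_d.2.1).1)
    rcases mem_insert.1 h' with e | h'
    · exact hv_dg_b (e ▸ (mem_varSet_of_pair hG_d.2.1).1)
    rcases mem_insert.1 h' with e | h'
    · exact hv_dgₐ (e ▸ (mem_varSet_of_pair hG_d.2.1).1)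
    · exact hg_dJ h'
  -- costs `+2`, `0`, `+2`, `0`
  have s₁ := card_bdry_insert_le_gen I hgₐJ (T := {vₐ}) (singleton_subset_iff.2 (mem_varSet_of_pair hGₐ.2.1).1) (singleton_subset_iff.2 bₐ)
  rw [card_singleton] at s₁
  have hzb : z ∈ bdry I (insert gₐ J₀) := partner_mem_bdry_insert hzₐ hGₐ.2.2
  have s₂ := card_bdry_insert_le_gen I hg_bX (T := {v_b, z})
    (insert_subset_iff.2 ⟨(mem_varSet_of_pair hG_b.2.1).1, singleton_subset_iff.2 (mem_varSet_of_pair hG_b.2.1).2⟩)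
    (insert_subset_iff.2 ⟨mem_bdry_insert_of_not_mem I b_b hv_bgₐ, singleton_subset_iff.2 hzb⟩)
  rw [card_pair hv_bz] at s₂
  have s₃ := card_bdry_insert_le_gen I hg_cX (T := {v_c}) (singleton_subset_iff.2 (mem_varSet_of_pair hG_c.2.1).1)
    (singleton_subset_iff.2 (mem_bdry_insert_of_not_mem I (mem_bdry_insert_of_not_mem I b_c hv_cgₐ) hv_cg_b))
  rw [card_singleton] at s₃
  have hz'b : z' ∈ bdry I (insert g_c (insert g_b (insert gₐ J₀))) :=
    partner_mem_bdry_insert hz'_c fun j hj => by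
      rcases mem_insert.1 hj with rfl | hj
      · exact hz'g_b
      rcases mem_insert.1 hj with rfl | hj
      · exact hz'gₐ
      · exact hG_c.2.2 j hj
  have s₄ := card_bdry_insert_le_gen I hg_dX (T := {v_d, z'})
    (insert_subset_iff.2 ⟨(mem_varSet_of_pair hG_d.2.1).1, singleton_subset_iff.2 (mem_varSet_of_pair hG_d.2.1).2⟩)
    (insert_subset_iff.2 ⟨mem_bdry_insert_of_not_mem I (mem_bdry_insert_of_not_mem I (mem_bdry_insert_of_not_mem I b_d hv_dgₐ) hv_dg_b)
      hv_dg_c, singleton_subset_iff.2 hz'b⟩)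
  rw [card_pair hv_dz'] at s₄
  have hsub : insert g_d (insert g_c (insert g_b (insert gₐ J₀))) ⊆ J₀ ∪ w₁.2.1 ∪ w₂.2.1 :=
    insert_sub_U hg_d (insert_sub_U hg_c (insert_sub_U hg_b (insert_sub_U hgₐ J_sub_U)))
  have hexp := hB _ ((card_le_card hsub).trans ht.2.2.2.2.2.1)
  rw [card_insert_of_notMem hg_dX, card_insert_of_notMem hg_cX, card_insert_of_notMem hg_bX, card_insert_of_notMem hgₐJ] at hexp
  omega


/-! ## Four generic chords -/

/-- **A terminal core with boundary slack at most two has no FOUR distinct slice-generic chords.** -/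
theorem false_of_slackTwo_four_generic (hI : I.IsPure xorAndPred) (hT : Typed I) (hS : SimpleOverlap I) (hB : BoundaryExpanding r I)
    (ht : Terminal I r y J₀ w₁ w₂) (hslack : 2 * (bdry I J₀).card ≤ 3 * J₀.card + 2) {c₁ c₂ c₃ c₄ : Fin m} (hc₁ : c₁ ∈ J₀) (hc₂ : c₂ ∈ J₀)
    (hc₃ : c₃ ∈ J₀) (hc₄ : c₄ ∈ J₀) (h₁₂ : c₁ ≠ c₂) (h₁₃ : c₁ ≠ c₃) (h₁₄ : c₁ ≠ c₄) (h₂₃ : c₂ ≠ c₃) (h₂₄ : c₂ ≠ c₄) (h₃₄ : c₃ ≠ c₄)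
    (hch₁ : IsChord I J₀ c₁) (hch₂ : IsChord I J₀ c₂) (hch₃ : IsChord I J₀ c₃) (hch₄ : IsChord I J₀ c₄)
    (hg₁ : SliceGeneric I y J₀ c₁ (w₁.2.1 ∪ w₂.2.1)) (hg₂ : SliceGeneric I y J₀ c₂ (w₁.2.1 ∪ w₂.2.1))
    (hg₃ : SliceGeneric I y J₀ c₃ (w₁.2.1 ∪ w₂.2.1)) (hg₄ : SliceGeneric I y J₀ c₄ (w₁.2.1 ∪ w₂.2.1)) : False := by
  -- two outside-gated chords without a common partner die by the two-chord theorem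
  have kill : ∀ {cᵢ cⱼ : Fin m}, cᵢ ∈ J₀ → cⱼ ∈ J₀ → cᵢ ≠ cⱼ → IsChord I J₀ cᵢ → IsChord I J₀ cⱼ →
      SliceGeneric I y J₀ cᵢ (w₁.2.1 ∪ w₂.2.1) → SliceGeneric I y J₀ cⱼ (w₁.2.1 ∪ w₂.2.1) →
      OutsideGated I J₀ (w₁.2.1 ∪ w₂.2.1) cᵢ → OutsideGated I J₀ (w₁.2.1 ∪ w₂.2.1) cⱼ →
      ¬ (∃ z, Partner I J₀ (w₁.2.1 ∪ w₂.2.1) cᵢ z ∧ Partner I J₀ (w₁.2.1 ∪ w₂.2.1) cⱼ z) → False :=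
    fun hcᵢ hcⱼ hne hchᵢ hchⱼ hgᵢ hgⱼ hOᵢ hOⱼ hns =>
      false_of_two_gated hI hT hS hB ht hcᵢ hcⱼ hne hchᵢ hchⱼ hOᵢ hOⱼ (fun z h h' => hns ⟨z, h, h'⟩) hgᵢ hgⱼ
  -- a sharing pair `(a, b)` forces the complementary pair `(c, d)` to be outside-gated and non-sharing
  have shared : ∀ {a b c d : Fin m}, a ∈ J₀ → b ∈ J₀ → c ∈ J₀ → d ∈ J₀ → a ≠ b → a ≠ c → a ≠ d → b ≠ c → b ≠ d → c ≠ d →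
      IsChord I J₀ a → IsChord I J₀ b → IsChord I J₀ c → IsChord I J₀ d →
      SliceGeneric I y J₀ c (w₁.2.1 ∪ w₂.2.1) → SliceGeneric I y J₀ d (w₁.2.1 ∪ w₂.2.1) →
      (∃ z, Partner I J₀ (w₁.2.1 ∪ w₂.2.1) a z ∧ Partner I J₀ (w₁.2.1 ∪ w₂.2.1) b z) → False := by
    intro a b c d ha hb hc hd hab hac had hbc hbd hcd hcha hchb hchc hchd hgc hgd hz
    obtain ⟨z, hPa, hPb⟩ := hz
    have hOc := outsideGated_of_shared hI hT hB ht hslack ha hb hc hab hac hbc hcha hchb hchc hPa hPb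
    have hOd := outsideGated_of_shared hI hT hB ht hslack ha hb hd hab had hbd hcha hchb hchd hPa hPb
    refine kill hc hd hcd hchc hchd hgc hgd hOc hOd fun ⟨z', hPc, hPd⟩ => ?_
    by_cases e : z = z'
    · subst e
      exact no_three_on_partner hI hT hB ht hslack ha hb hc hab hac hbc hcha hchb hchc hPa hPb hPc
    · exact no_two_sharing_pairs hT hB ht hslack ha hb hc hd hab hac had hbc hbd hcd hcha hchb hchc hchd e hPa hPb hPc hPd
  by_cases s₁₂ : ∃ z, Partner I J₀ (w₁.2.1 ∪ w₂.2.1) c₁ z ∧ Partner I J₀ (w₁.2.1 ∪ w₂.2.1) c₂ z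
  · exact shared hc₁ hc₂ hc₃ hc₄ h₁₂ h₁₃ h₁₄ h₂₃ h₂₄ h₃₄ hch₁ hch₂ hch₃ hch₄ hg₃ hg₄ s₁₂
  by_cases s₁₃ : ∃ z, Partner I J₀ (w₁.2.1 ∪ w₂.2.1) c₁ z ∧ Partner I J₀ (w₁.2.1 ∪ w₂.2.1) c₃ z
  · exact shared hc₁ hc₃ hc₂ hc₄ h₁₃ h₁₂ h₁₄ h₂₃.symm h₃₄ h₂₄ hch₁ hch₃ hch₂ hch₄ hg₂ hg₄ s₁₃
  by_cases s₁₄ : ∃ z, Partner I J₀ (w₁.2.1 ∪ w₂.2.1) c₁ z ∧ Partner I J₀ (w₁.2.1 ∪ w₂.2.1) c₄ z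
  · exact shared hc₁ hc₄ hc₂ hc₃ h₁₄ h₁₂ h₁₃ h₂₄.symm h₃₄.symm h₂₃ hch₁ hch₄ hch₂ hch₃ hg₂ hg₃ s₁₄
  by_cases s₂₃ : ∃ z, Partner I J₀ (w₁.2.1 ∪ w₂.2.1) c₂ z ∧ Partner I J₀ (w₁.2.1 ∪ w₂.2.1) c₃ z
  · exact shared hc₂ hc₃ hc₁ hc₄ h₂₃ h₁₂.symm h₂₄ h₁₃.symm h₃₄ h₁₄ hch₂ hch₃ hch₁ hch₄ hg₁ hg₄ s₂₃
  by_cases s₂₄ : ∃ z, Partner I J₀ (w₁.2.1 ∪ w₂.2.1) c₂ z ∧ Partner I J₀ (w₁.2.1 ∪ w₂.2.1) c₄ z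
  · exact shared hc₂ hc₄ hc₁ hc₃ h₂₄ h₁₂.symm h₂₃ h₁₄.symm h₃₄.symm h₁₃ hch₂ hch₄ hch₁ hch₃ hg₁ hg₃ s₂₄
  by_cases s₃₄ : ∃ z, Partner I J₀ (w₁.2.1 ∪ w₂.2.1) c₃ z ∧ Partner I J₀ (w₁.2.1 ∪ w₂.2.1) c₄ z
  · exact shared hc₃ hc₄ hc₁ hc₂ h₃₄ h₁₃.symm h₂₃.symm h₁₄.symm h₂₄.symm h₁₂ hch₃ hch₄ hch₁ hch₂ hg₁ hg₂ s₃₄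
  -- no sharing pair: two of the four are outside-gated (F1 twice)
  rcases outsideGated_of_three hI hT hB ht hslack hc₁ hc₂ hc₃ h₁₂ h₁₃ h₂₃ hch₁ hch₂ hch₃ with hO₁ | hO₂ | hO₃
  · rcases outsideGated_of_three hI hT hB ht hslack hc₂ hc₃ hc₄ h₂₃ h₂₄ h₃₄ hch₂ hch₃ hch₄ with hO₂ | hO₃ | hO₄
    · exact kill hc₁ hc₂ h₁₂ hch₁ hch₂ hg₁ hg₂ hO₁ hO₂ s₁₂
    · exact kill hc₁ hc₃ h₁₃ hch₁ hch₃ hg₁ hg₃ hO₁ hO₃ s₁₃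
    · exact kill hc₁ hc₄ h₁₄ hch₁ hch₄ hg₁ hg₄ hO₁ hO₄ s₁₄
  · rcases outsideGated_of_three hI hT hB ht hslack hc₁ hc₃ hc₄ h₁₃ h₁₄ h₃₄ hch₁ hch₃ hch₄ with hO₁ | hO₃ | hO₄
    · exact kill hc₁ hc₂ h₁₂ hch₁ hch₂ hg₁ hg₂ hO₁ hO₂ s₁₂
    · exact kill hc₂ hc₃ h₂₃ hch₂ hch₃ hg₂ hg₃ hO₂ hO₃ s₂₃
    · exact kill hc₂ hc₄ h₂₄ hch₂ hch₄ hg₂ hg₄ hO₂ hO₄ s₂₄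
  · rcases outsideGated_of_three hI hT hB ht hslack hc₁ hc₂ hc₄ h₁₂ h₁₄ h₂₄ hch₁ hch₂ hch₄ with hO₁ | hO₂ | hO₄
    · exact kill hc₁ hc₃ h₁₃ hch₁ hch₃ hg₁ hg₃ hO₁ hO₃ s₁₃
    · exact kill hc₂ hc₃ h₂₃ hch₂ hch₃ hg₂ hg₃ hO₂ hO₃ s₂₃
    · exact kill hc₃ hc₄ h₃₄ hch₃ hch₄ hg₃ hg₄ hO₃ hO₄ s₃₄

end Counts

/-! ## O1 up to fourteen outputs -/
section Fourteen

variable {I : LocalMap 4 n m} {r : ℕ}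

/-- **A fourteen-output XOR-closed family with a centre cycle has boundary slack at most two** (`#bdry ≤ 22`). -/
theorem slackTwo_of_centre_fourteen (I : LocalMap 4 n m) (hI : I.IsPure xorAndPred) (hT : Typed I) (hS : SimpleOverlap I)
    (hB : BoundaryExpanding r I) {J₀ : Finset (Fin m)} (hX : XorClosed I J₀) (hr : J₀.card ≤ r) (hk : J₀.card = 14) {S : Finset (Fin m)}
    (hSJ : S ⊆ J₀) (hne : S.Nonempty) (hL : ∀ w ∈ xverts I S, 2 ≤ xpdeg I S w) (hnc : ∀ f ∈ S, ¬ IsChord I J₀ f) :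
    2 * (bdry I J₀).card ≤ 3 * J₀.card + 2 := by
  have h₁ := twelve_le_two_mul_card_sharedSlots I hI hT hS hB hr hSJ hne hL hnc
  have h₂ := card_bdry_add_card_sharedSlots_le I J₀ hX
  omega

/-- **O1 FOR CORES OF AT MOST FOURTEEN OUTPUTS** from (H₁₂), (H₁₃) (as in `PstarChordReadSlackOne.peelable_of_card_le_thirteen`) and (H₁₄) four
distinct slice-generic chords on every fourteen-output terminal core with a centre cycle and `#bdry ≤ 22`. -/
theorem peelable_of_card_le_fourteen (hI : I.IsPure xorAndPred) (hT : Typed I) (hS : SimpleOverlap I) (hB : BoundaryExpanding r I)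
    (h₁₂ : ∀ (y : Fin m → Bool) (J₀ : Finset (Fin m)) (w₁ w₂ : Finset (Fin n) × Finset (Fin m) × Bool), Terminal I r y J₀ w₁ w₂ →
      J₀.card = 12 → 2 * (sharedSlots I J₀).card = J₀.card →
      (∃ S ⊆ J₀, S.Nonempty ∧ (∀ w ∈ xverts I S, 2 ≤ xpdeg I S w) ∧ ∀ f ∈ S, ¬ IsChord I J₀ f) →
      ∃ cᵢ ∈ J₀, ∃ cⱼ ∈ J₀, cᵢ ≠ cⱼ ∧ IsChord I J₀ cᵢ ∧ IsChord I J₀ cⱼ ∧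
        SliceGeneric I y J₀ cᵢ (w₁.2.1 ∪ w₂.2.1) ∧ SliceGeneric I y J₀ cⱼ (w₁.2.1 ∪ w₂.2.1))
    (h₁₃ : ∀ (y : Fin m → Bool) (J₀ : Finset (Fin m)) (w₁ w₂ : Finset (Fin n) × Finset (Fin m) × Bool), Terminal I r y J₀ w₁ w₂ →
      J₀.card = 13 → 2 * (bdry I J₀).card ≤ 3 * J₀.card + 1 →
      (∃ S ⊆ J₀, S.Nonempty ∧ (∀ w ∈ xverts I S, 2 ≤ xpdeg I S w) ∧ ∀ f ∈ S, ¬ IsChord I J₀ f) →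
      ∃ c₁ ∈ J₀, ∃ c₂ ∈ J₀, ∃ c₃ ∈ J₀, c₁ ≠ c₂ ∧ c₁ ≠ c₃ ∧ c₂ ≠ c₃ ∧ IsChord I J₀ c₁ ∧ IsChord I J₀ c₂ ∧ IsChord I J₀ c₃ ∧
        SliceGeneric I y J₀ c₁ (w₁.2.1 ∪ w₂.2.1) ∧ SliceGeneric I y J₀ c₂ (w₁.2.1 ∪ w₂.2.1) ∧ SliceGeneric I y J₀ c₃ (w₁.2.1 ∪ w₂.2.1))
    (h₁₄ : ∀ (y : Fin m → Bool) (J₀ : Finset (Fin m)) (w₁ w₂ : Finset (Fin n) × Finset (Fin m) × Bool), Terminal I r y J₀ w₁ w₂ →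
      J₀.card = 14 → 2 * (bdry I J₀).card ≤ 3 * J₀.card + 2 →
      (∃ S ⊆ J₀, S.Nonempty ∧ (∀ w ∈ xverts I S, 2 ≤ xpdeg I S w) ∧ ∀ f ∈ S, ¬ IsChord I J₀ f) →
      ∃ c₁ ∈ J₀, ∃ c₂ ∈ J₀, ∃ c₃ ∈ J₀, ∃ c₄ ∈ J₀, c₁ ≠ c₂ ∧ c₁ ≠ c₃ ∧ c₁ ≠ c₄ ∧ c₂ ≠ c₃ ∧ c₂ ≠ c₄ ∧ c₃ ≠ c₄ ∧
        IsChord I J₀ c₁ ∧ IsChord I J₀ c₂ ∧ IsChord I J₀ c₃ ∧ IsChord I J₀ c₄ ∧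
        SliceGeneric I y J₀ c₁ (w₁.2.1 ∪ w₂.2.1) ∧ SliceGeneric I y J₀ c₂ (w₁.2.1 ∪ w₂.2.1) ∧ SliceGeneric I y J₀ c₃ (w₁.2.1 ∪ w₂.2.1) ∧
        SliceGeneric I y J₀ c₄ (w₁.2.1 ∪ w₂.2.1))
    {y : Fin m → Bool} {J₀ : Finset (Fin m)} {w₁ w₂ : Finset (Fin n) × Finset (Fin m) × Bool} (ht : Terminal I r y J₀ w₁ w₂)
    (hk : J₀.card ≤ 14) : Peelable I (nonchords I J₀) := by
  rcases Nat.lt_or_ge J₀.card 14 with hlt | hge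
  · exact peelable_of_card_le_thirteen hI hT hS hB h₁₂ h₁₃ ht (by omega)
  · have hk14 : J₀.card = 14 := le_antisymm hk hge
    have hX : XorClosed I J₀ := ht.2.1
    have hr : J₀.card ≤ r := ht.2.2.1.le
    by_contra hnp
    obtain ⟨S, hSJ, hne, hL, hnc⟩ := exists_centre_of_not_peelable I hnp
    have hslack := slackTwo_of_centre_fourteen I hI hT hS hB hX hr hk14 hSJ hne hL hnc
    obtain ⟨c₁, hc₁, c₂, hc₂, c₃, hc₃, c₄, hc₄, h₁₂', h₁₃', h₁₄', h₂₃, h₂₄, h₃₄, hch₁, hch₂, hch₃, hch₄, hg₁, hg₂, hg₃, hg₄⟩ :=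
      h₁₄ y J₀ w₁ w₂ ht hk14 hslack ⟨S, hSJ, hne, hL, hnc⟩
    exact false_of_slackTwo_four_generic hI hT hS hB ht hslack hc₁ hc₂ hc₃ hc₄ h₁₂' h₁₃' h₁₄' h₂₃ h₂₄ h₃₄ hch₁ hch₂ hch₃ hch₄
      hg₁ hg₂ hg₃ hg₄

end Fourteen

end Summit.PneNP.PneNP.Theorems.PstarChordReadSlackTwoFour
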